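import Summits.BirchSwinnertonDyer.BirchSwinnertonDyer.Theorems.ByReductionTypeAtTwoMultTransportKlein
import Literature.NumberTheory.EllipticCurves.IsogenyTwoTorsionProofs
import Literature.NumberTheory.EllipticCurves.VariableChangePoints
import Mathlib.Data.Rat.Sqrt
import HarnessLib

/-!
# T-42 in the kernel, CII — «F1 ROAD» brick B5 (h): THE TWO-TORSION NORMAL FORM AND THE RATIONAL `2`-TORSION OF THE EXPLICIT
# `2`-ISOGENY QUOTIENT — for a rational point `P₀ = (x₀, y₀)` of order `2` on `W/ℚ`: a change of variables to `E : y² = X³ + aX² + bX` with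
# `P₀ ↦ (0, 0)`, `b = 3x₀² + (b₂/2)x₀ + b₄/2`; and Silverman's quotient `E′ : Y² = X³ − 2aX² + (a² − 4b)X` has EXACTLY ONE rational point of
# order `2` iff `b` is not a square in `ℚ` (audit-2 D-NOTE B5-CHAIN@2 §3 (β), kernel)

Cell `bsd-2adic` (run/shared/lean/pub/bsd-2adic/), seat `bsd-2adic-t42` GEN 34 (pen RC-540 SUMMON, brick B5 of road (S-C′), memo
`t42/DESIGN-T42-ADDENDUM-38.md`). HONEST FRAMING: research route; THEOREMS ONLY (no `def`, no named fact, no instance, no `sorry`); nothing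
booked; no door or class file is touched (k6); BSD is not proved by any of this. PARTITION: X5@2 multiplicative GV-transport rows (K4ᵐ B1·O1;
items 19922 / 19923) × p = 2 — reduces-the-named-input-of (XCII's side condition `hB`); bears_on K4 (`--supports stmt-BirchSwinnertonDyer-19923`).

## What

* §1 rational `2`-torsion abscissas move along a change of variables: `hasRationalTwoTorsionX_smul_iff` (`(C • W, z)` ↔ `(W, u²z + r)`),
  `hasUniqueRationalTwoTorsionX_smul_iff` (tree `VariableChange.equation_iff`, `evalEval_polynomialY_toXY`; Silverman III.1).
* §2 `exists_variableChange_twoTorsionNF` — for `W/ℚ` and a rational `(x₀, y₀)` with `2y₀ + a₁x₀ + a₃ = 0` on `W`: a change of variables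
  `C = (1, x₀, −a₁/2, −(a₃ + x₀a₁)/2)` with `C • W` in two-torsion normal form (`a₁ = a₃ = a₆ = 0`), `C(x₀, y₀) = (0, 0)`, and
  `(C • W).a₄ = 3x₀² + (b₂/2)x₀ + b₄/2` (completing the square and translating; AEC III.1).
* §3 `hasRationalTwoTorsionX_twoIsogenyCodomain_iff` — on `E′ = E.twoIsogenyCodomain` (`E` in normal form): `(X, ·)` is a rational point of
  order `2` iff `X = 0 ∨ (X − a₂(E))² = 4a₄(E)`; hence `hasUniqueRationalTwoTorsionX_twoIsogenyCodomain_zero_iff`: `E′` has exactly one rational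
  point of order `2` (the generator `(0, 0)` of the dual kernel) **iff `¬ IsSquare (E.a₄)`** — D-NOTE (β) «`W/⟨P₀⟩` is a full-`2`-torsion
  curve iff `b ∈ (ℚˣ)²`», decidable (`Mathlib.Data.Rat.Sqrt`).

The sequel (CIII) assembles: `W` type A with `¬ IsSquare (3x² + (b₂/2)x + b₄/2)` ⟹ the explicit quotient `C′ • E′` (globally minimal) has a
unique rational `2`-torsion abscissa ⟹ certificate (XCIX flip) ⟹ the transport from FIVE print facts with a DECIDABLE side condition.

References: [SilvermanAEC2009] III.1 (Table 3.1), III.4 Example 4.5, X.4 Prop. 4.9; audit-2 D-NOTE B5-CHAIN@2 §3.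
-/

set_option autoImplicit false
set_option linter.dupNamespace false

noncomputable section

open scoped Classical

namespace Summit.BirchSwinnertonDyer.BirchSwinnertonDyer.Theorems.MultTransportTwistedDescent

open WeierstrassCurve Literature.NumberTheory.EllipticCurves Literature.NumberTheory.EllipticCurves.Greenberg1999

/-! ## §1. Rational `2`-torsion abscissas under a change of variables -/

section Smul

variable (W : WeierstrassCurve ℚ) (C : VariableChange ℚ)

/-- `(C • W)` has a rational point of order `2` with abscissa `C.toX x` iff `W` has one with abscissa `x` (the substitution
`(x, y) ↦ (u⁻²(x − r), u⁻³(y − s(x − r) − t))` preserves the equation and scales `2y + a₁x + a₃` by `u⁻³`). [cite: SilvermanAEC2009, III.1 Table 3.1] -/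
theorem hasRationalTwoTorsionX_smul_toX_iff (x : ℚ) :
    HasRationalTwoTorsionX (C • W) (C.toX x) ↔ HasRationalTwoTorsionX W x := by
  constructor
  · rintro ⟨y', hEq, h2⟩
    -- pull `y'` back: `y' = C.toY x y` with `y = C.ofY (C.toX x) y'`
    have key : C.toY x (C.ofY (C.toX x) y') = y' := by
      have h := VariableChange.toY_ofY C (C.toX x) y'
      rwa [VariableChange.ofX_toX] at h
    refine ⟨C.ofY (C.toX x) y', ?_, ?_⟩
    · have h := (VariableChange.equation_iff W C x (C.ofY (C.toX x) y')).mp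
      rw [key] at h
      exact h hEq
    · have h := VariableChange.evalEval_polynomialY_toXY W C x (C.ofY (C.toX x) y')
      rw [key, Affine.evalEval_polynomialY, Affine.evalEval_polynomialY] at h
      have hu : ((C.u⁻¹ : ℚˣ) : ℚ) ^ 3 ≠ 0 := pow_ne_zero 3 (Units.ne_zero _)
      have : ((C.u⁻¹ : ℚˣ) : ℚ) ^ 3 * (2 * C.ofY (C.toX x) y' + W.a₁ * x + W.a₃) = 0 := by
        rw [← h]; exact h2
      exact (mul_eq_zero.mp this).resolve_left hu
  · rintro ⟨y, hEq, h2⟩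
    refine ⟨C.toY x y, (VariableChange.equation_iff W C x y).mpr hEq, ?_⟩
    have h := VariableChange.evalEval_polynomialY_toXY W C x y
    rw [Affine.evalEval_polynomialY, Affine.evalEval_polynomialY] at h
    rw [h, h2, mul_zero]

/-- `(C • W)` has a rational point of order `2` with abscissa `z` iff `W` has one with abscissa `C.ofX z = u²z + r`.
[cite: SilvermanAEC2009, III.1 Table 3.1] -/
theorem hasRationalTwoTorsionX_smul_iff (z : ℚ) :
    HasRationalTwoTorsionX (C • W) z ↔ HasRationalTwoTorsionX W (C.ofX z) := by
  rw [← hasRationalTwoTorsionX_smul_toX_iff W C (C.ofX z), VariableChange.toX_ofX]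

/-- UNIQUE rational `2`-torsion moves along a change of variables: `(C • W, C.toX x)` iff `(W, x)`.
[cite: SilvermanAEC2009, III.1 Table 3.1] [cite: GreenbergLNM1716, Prop. 5.14 (the predicate)] -/
theorem hasUniqueRationalTwoTorsionX_smul_toX_iff (x : ℚ) :
    HasUniqueRationalTwoTorsionX (C • W) (C.toX x) ↔ HasUniqueRationalTwoTorsionX W x := by
  constructor
  · rintro ⟨hx, huniq⟩
    refine ⟨(hasRationalTwoTorsionX_smul_toX_iff W C x).mp hx, fun z hz ↦ ?_⟩
    exact C.toX_injective (huniq (C.toX z) ((hasRationalTwoTorsionX_smul_toX_iff W C z).mpr hz))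
  · rintro ⟨hx, huniq⟩
    refine ⟨(hasRationalTwoTorsionX_smul_toX_iff W C x).mpr hx, fun z hz ↦ ?_⟩
    have h := huniq (C.ofX z) ((hasRationalTwoTorsionX_smul_iff W C z).mp hz)
    rw [← h, VariableChange.toX_ofX]

end Smul

/-! ## §2. The two-torsion normal form of `(W, P₀)` -/

/-- **Two-torsion normal form.** For `W/ℚ` and a rational affine point `(x₀, y₀)` with `2y₀ + a₁x₀ + a₃ = 0` on `W` (a point of order `2`):
the change of variables `C = (u, r, s, t) = (1, x₀, −a₁/2, −(a₃ + x₀a₁)/2)` puts `W` in two-torsion normal form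
`C • W : y² = X³ + aX² + bX` with `C(x₀, y₀) = (0, 0)`, `a = 3x₀ + b₂/4` and **`b = 3x₀² + (b₂/2)x₀ + b₄/2`** (complete the square, translate
`x ↦ X + x₀`; `a₆ = 0` is the equation at `P₀`). [cite: SilvermanAEC2009, III.1 (Table 3.1) and III.4 Example 4.5] -/
theorem exists_variableChange_twoTorsionNF (W : WeierstrassCurve ℚ) {x₀ y₀ : ℚ} (hxy : W.toAffine.Equation x₀ y₀)
    (h2 : 2 * y₀ + W.a₁ * x₀ + W.a₃ = 0) :
    ∃ C : VariableChange ℚ, (C • W).IsTwoTorsionNF ∧ C.toX x₀ = 0 ∧ C.toY x₀ y₀ = 0 ∧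
      (C • W).a₂ = 3 * x₀ + W.b₂ / 4 ∧ (C • W).a₄ = 3 * x₀ ^ 2 + W.b₂ / 2 * x₀ + W.b₄ / 2 := by
  rw [Affine.equation_iff] at hxy
  refine ⟨⟨1, x₀, -(W.a₁ / 2), -((W.a₃ + x₀ * W.a₁) / 2)⟩, ⟨?_, ?_, ?_⟩, ?_, ?_, ?_, ?_⟩
  · rw [variableChange_a₁]; simp; ring
  · rw [variableChange_a₃]; simp; ring
  · rw [variableChange_a₆]; simp
    linear_combination (-(1 : ℚ)) * hxy + ((2 * y₀ + W.a₁ * x₀ + W.a₃) / 4) * h2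
  · simp [VariableChange.toX_def]
  · simp [VariableChange.toY_def]; linear_combination (1 / 2 : ℚ) * h2
  · rw [variableChange_a₂]; simp [b₂]; ring
  · rw [variableChange_a₄]; simp [b₂, b₄]; ring

/-! ## §3. Rational `2`-torsion of Silverman's `2`-isogeny quotient `E′ : Y² = X³ − 2aX² + (a² − 4b)X` -/

section Codomain

variable (E : WeierstrassCurve ℚ) [E.IsTwoTorsionNF]

omit [E.IsTwoTorsionNF] in
/-- **The rational points of order `2` of `E′ = E.twoIsogenyCodomain`**: `(X, Y)` with `2Y = 0` on `Y² = X³ − 2aX² + (a² − 4b)X` means `Y = 0`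
and `X · ((X − a)² − 4b) = 0`. [cite: SilvermanAEC2009, III.4 Example 4.5 and X.4 Prop. 4.9] -/
theorem hasRationalTwoTorsionX_twoIsogenyCodomain_iff (X : ℚ) :
    HasRationalTwoTorsionX E.twoIsogenyCodomain X ↔ X = 0 ∨ (X - E.a₂) ^ 2 = 4 * E.a₄ := by
  constructor
  · rintro ⟨Y, hEq, h2⟩
    rw [equation_iff_of_isTwoTorsionNF] at hEq
    have ha₁ : E.twoIsogenyCodomain.a₁ = 0 := rfl
    have ha₃ : E.twoIsogenyCodomain.a₃ = 0 := rfl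
    rw [ha₁, ha₃, zero_mul, add_zero, add_zero] at h2
    have hY : Y = 0 := by linarith
    rw [hY] at hEq
    have ha₂ : E.twoIsogenyCodomain.a₂ = -2 * E.a₂ := rfl
    have ha₄ : E.twoIsogenyCodomain.a₄ = E.a₂ ^ 2 - 4 * E.a₄ := rfl
    rw [ha₂, ha₄] at hEq
    have hfac : X * ((X - E.a₂) ^ 2 - 4 * E.a₄) = 0 := by linear_combination -hEq
    rcases mul_eq_zero.mp hfac with h | h
    · exact Or.inl h
    · exact Or.inr (sub_eq_zero.mp h)
  · intro h
    refine ⟨0, ?_, by simp⟩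
    rw [equation_iff_of_isTwoTorsionNF, show E.twoIsogenyCodomain.a₂ = -2 * E.a₂ from rfl,
      show E.twoIsogenyCodomain.a₄ = E.a₂ ^ 2 - 4 * E.a₄ from rfl]
    rcases h with rfl | h
    · ring
    · linear_combination -X * h

/-- **(β) in the kernel: `E′` has EXACTLY ONE rational point of order `2` — namely `(0, 0)`, the generator of the dual kernel — iff `b = a₄(E)` is
NOT a square in `ℚ`** (the other two `2`-torsion abscissas are `a ± 2√b`). Audit-2 D-NOTE B5-CHAIN@2 §3 (β): «`W₁ = W/⟨P₀⟩` does not have full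
rational `2`-torsion iff `b ∉ (ℚˣ)²`». [cite: SilvermanAEC2009, III.4 Example 4.5 and X.4 Prop. 4.9] -/
theorem hasUniqueRationalTwoTorsionX_twoIsogenyCodomain_zero_iff [E.IsElliptic] :
    HasUniqueRationalTwoTorsionX E.twoIsogenyCodomain 0 ↔ ¬ IsSquare E.a₄ := by
  constructor
  · rintro ⟨-, huniq⟩ ⟨c, hc⟩
    -- `X = a₂ + 2c` is a second abscissa
    have hX : HasRationalTwoTorsionX E.twoIsogenyCodomain (E.a₂ + 2 * c) :=
      (hasRationalTwoTorsionX_twoIsogenyCodomain_iff E _).mpr (Or.inr (by rw [hc]; ring))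
    have h0 := huniq _ hX
    -- then `a₂ = -2c` and `b = c²` give `a₂² - 4a₄ = 0`, contradicting ellipticity
    have hb : E.a₂ ^ 2 - 4 * E.a₄ = 0 := by
      have hc' : E.a₂ = -2 * c := by linarith
      rw [hc', hc]; ring
    exact a₂_sq_sub_ne_zero E hb
  · intro hb
    refine ⟨(hasRationalTwoTorsionX_twoIsogenyCodomain_iff E 0).mpr (Or.inl rfl), fun z hz ↦ ?_⟩
    rcases (hasRationalTwoTorsionX_twoIsogenyCodomain_iff E z).mp hz with h | h
    · exact h
    · exact absurd ⟨(z - E.a₂) / 2, by linear_combination (-(1 : ℚ) / 4) * h⟩ hb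

end Codomain

end Summit.BirchSwinnertonDyer.BirchSwinnertonDyer.Theorems.MultTransportTwistedDescent

end
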